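import Mathlib
import Summits.ResolutionOfSingularities.ResolutionOfSingularities.Theorems.WeightedInvariantLocalWeightedDropNCDirectrixCutPairLiftShadow
import Summits.ResolutionOfSingularities.ResolutionOfSingularities.Theorems.WeightedInvariantLocalWeightedDropTOT2BridgePresentedExit
import Summits.ResolutionOfSingularities.ResolutionOfSingularities.Theorems.WeightedInvariantLocalWeightedDropNCResSettingPermissible

/-!
# `WeightedInvariant.LocalWeightedDrop`: LINE `directrix-cut`, SNC₂ — THE x₀-LIFT (4/5): THE EXIT AND THE START

OURS (res-L1-w43-stub-4 g6 for the ENGINE crux `LocalWeightedDrop` stmt-ResolutionOfSingularities-8899, W′|₄ line, R₂ corner, piece LIFT of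
res-L1-w43-strat-1's `stub_pairLift` (g11 `snc2_interface_v1.lean` e57a74989d55635b); candidates, not facts; counted 0).  THE x₀-LIFT transports a
`(m+1)`-variable B-permissible decorated strategy (`TameFourTupleDrop.DBWinsTo`, res-L1-w43-lead-1 p575221) along the product structure of a pair
position `Φ^*f = u · X₀ · (X₀ + g(x₁…x_{m+1}))`: lifted moves `(Φ;Λ(Ψ), (1,w))` with `Λ(Ψ) = (X₀, rename succ ∘ Ψ)`; answers with `c₀ ≠ 0` exit by a
head drop, answers with `c₀ = 0` are pair positions over the shadow's transform, normal-crossing shadows are monomial pair positions.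

THIS FILE: EXIT — a normal-crossing shadow makes the position a monomial pair (heredity `TrackC.exists_unit_mul_monomial_of_dvd_pow`; a legal
coordinate reading a monomial is a variable); START — from two smooth branches `u·(X₀+g₁)(X₀+g₂)` the shear `x₀ ↦ x₀ − g₁` gives a pair position
over the ADMISSIBLE SHADOW `(g₃·∏ letters, (f₃, E₃, ∅))`, `f₃` = the squarefree representative of `g₃ = g₂ − g₁` with the letters stripped.
-/

set_option linter.dupNamespace false

noncomputable section

namespace Summit.ResolutionOfSingularities.ResolutionOfSingularities.Theorems

namespace TameFourTupleDrop

namespace PairLift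

open MvPowerSeries Literature.AlgebraicGeometry.Resolution

variable {k : Type} [Field k]

/-! # PART 7 — the exit: a normal-crossing shadow makes the position a monomial pair -/

section Exit

variable {m : ℕ}

/-- The order of a monomial `∏ Xᵢ^{eᵢ}` is `∑ eᵢ`. -/
theorem order_prod_X_pow {n : ℕ} (e : Fin n → ℕ) : (∏ i, (X i : MvPowerSeries (Fin n) k) ^ e i).order = ((∑ i, e i : ℕ) : ℕ∞) := by
  rw [order_prod, Nat.cast_sum]
  refine Finset.sum_congr rfl fun i _ => ?_
  rw [show (X i : MvPowerSeries (Fin n) k) ^ e i = ∏ _j ∈ Finset.range (e i), X i by rw [Finset.prod_const, Finset.card_range], order_prod,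
    Finset.sum_congr rfl fun _ _ => order_X' i, Finset.sum_const, Finset.card_range, nsmul_one]

/-- A monomial of total degree `1` is a variable. -/
theorem prod_X_pow_eq_X_of_sum_eq_one {n : ℕ} {e : Fin n → ℕ} (h : ∑ i, e i = 1) : ∃ j, (∏ i, (X i : MvPowerSeries (Fin n) k) ^ e i) = X j := by
  obtain ⟨j, hj⟩ : ∃ j, 1 ≤ e j := by
    by_contra hno
    push Not at hno
    have := Finset.sum_eq_zero (s := Finset.univ) (f := e) (fun t _ => by have := hno t; omega)
    omega
  have hrest : ∀ t, t ≠ j → e t = 0 := fun t htj => by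
    have h3 := Finset.add_sum_erase Finset.univ e (Finset.mem_univ j)
    have h4 := Finset.single_le_sum (f := e) (fun t _ => Nat.zero_le _) (Finset.mem_erase.mpr ⟨htj, Finset.mem_univ t⟩)
    omega
  have hjj : e j = 1 := by
    have := Finset.single_le_sum (f := e) (fun t _ => Nat.zero_le _) (Finset.mem_univ j)
    omega
  exact ⟨j, by rw [Finset.prod_eq_single j (fun t _ htj => by rw [hrest t htj, pow_zero]) (fun h => absurd (Finset.mem_univ j) h), hjj, pow_one]⟩

/-- **A LEGAL COORDINATE READING A MONOMIAL IS A VARIABLE**: if `Ψ` is legal and `Ψ_j = v · ∏ Xᵢ^{eᵢ}` with `v` a unit, then `Ψ_j = v · X_{j'}`. -/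
theorem exists_eq_unit_mul_X_of_legal {n : ℕ} {Ψ : Fin n → MvPowerSeries (Fin n) k} (hΨ0 : ∀ i, constantCoeff (Ψ i) = 0)
    (hΨdet : IsUnit (Matrix.det (Matrix.of fun i j => coeff (Finsupp.single j 1) (Ψ i)))) {j : Fin n} {v : MvPowerSeries (Fin n) k}
    (hv : constantCoeff v ≠ 0) {e : Fin n → ℕ} (h : Ψ j = v * ∏ i, X i ^ e i) : ∃ j', Ψ j = v * X j' := by
  -- the row `j` of the linear part is non-zero: `ord Ψ_j ≤ 1`
  obtain ⟨i₀, hi₀⟩ : ∃ i₀, coeff (Finsupp.single i₀ 1) (Ψ j) ≠ 0 := by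
    by_contra hno
    push Not at hno
    exact (isUnit_iff_ne_zero.mp hΨdet) (Matrix.det_eq_zero_of_row_eq_zero j fun i => by rw [Matrix.of_apply]; exact hno i)
  have hle : (Ψ j).order ≤ 1 := (order_le hi₀).trans (le_of_eq (by simp only [Finsupp.degree_single, Nat.cast_one]))
  have hge : (1 : ℕ∞) ≤ (Ψ j).order := one_le_order_iff_constCoeff_eq_zero.mpr (hΨ0 j)
  have hord : (Ψ j).order = ((∑ i, e i : ℕ) : ℕ∞) := by
    rw [h, order_mul, order_eq_zero_of_constantCoeff_ne_zero hv, zero_add, order_prod_X_pow]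
  rw [hord] at hle hge
  have hsum : ∑ i, e i = 1 := le_antisymm (by exact_mod_cast hle) (by exact_mod_cast hge)
  obtain ⟨j', hj'⟩ := prod_X_pow_eq_X_of_sum_eq_one (k := k) hsum
  exact ⟨j', by rw [h, hj']⟩

/-- **THE EXIT.**  If the shadow germ `b₃` is a normal crossing, the pair position `Φ^*f = u · X₀ · (X₀ + g)` with `g ∣ b₃ᵃ` and boundary letters over shadow
letters is a MONOMIAL PAIR position: through `Φ ; Λ(Ψ')` (`Ψ'` the normal-crossing coordinates of `b₃`) the equation reads
`u' · X₀ · (X₀ + v · ∏ X_{i+1}^{αᵢ})` and the boundary stays straight off `X₀`. -/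
theorem monomialPair_of_germIsNC {δ : Decoration k (m + 1)} {Φ : Fin (m + 1 + 1) → MvPowerSeries (Fin (m + 1 + 1)) k}
    (hΦ0 : ∀ l, constantCoeff (Φ l) = 0) (hΦdet : IsUnit (Matrix.det (Matrix.of fun i j => coeff (Finsupp.single j 1) (Φ i))))
    {u : MvPowerSeries (Fin (m + 1 + 1)) k} {g : MvPowerSeries (Fin (m + 1)) k} (hu : constantCoeff u ≠ 0)
    (hf : subst Φ δ.f = u * (X 0 * (X 0 + rename (Fin.succEmb (m + 1)) g))) {b₃ : MvPowerSeries (Fin (m + 1)) k} {δ₃ : Decoration k m}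
    (hadm₃ : Admissible b₃ δ₃)
    (hE : ∀ l ∈ δ.E, ∃ (j : Fin (m + 1)) (v : MvPowerSeries (Fin (m + 1 + 1)) k), constantCoeff v ≠ 0 ∧ Φ l = v * X j.succ ∧ j ∈ δ₃.E)
    {a : ℕ} (ha : g ∣ b₃ ^ a) (hnc : GermIsNC b₃) :
    ∃ (Φ' : Fin (m + 1 + 1) → MvPowerSeries (Fin (m + 1 + 1)) k) (u' v : MvPowerSeries (Fin (m + 1 + 1)) k) (α : Fin (m + 1) → ℕ),
      (∀ i, constantCoeff (Φ' i) = 0) ∧ IsUnit (Matrix.det (Matrix.of fun i j => coeff (Finsupp.single j 1) (Φ' i))) ∧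
      (∀ l ∈ δ.E, ∃ (l' : Fin (m + 1 + 1)) (w : MvPowerSeries (Fin (m + 1 + 1)) k), l' ≠ 0 ∧ constantCoeff w ≠ 0 ∧ Φ' l = w * X l') ∧
      constantCoeff u' ≠ 0 ∧ constantCoeff v ≠ 0 ∧
      subst Φ' δ.f = u' * (X 0 * (X 0 + v * ∏ i : Fin (m + 1), X (Fin.succ i) ^ α i)) := by
  obtain ⟨Ψ', U, e, hΨ'0, hΨ'det, hU, hb⟩ := hnc
  obtain ⟨v₃, α, hv₃, hgΨ⟩ := TrackC.exists_unit_mul_monomial_of_dvd_pow Ψ' hΨ'0 U hU e hb a (dvd_trans ha (pow_dvd_pow b₃ (Nat.le_succ a)))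
  obtain ⟨⟨M₃, N₃, -, hTb⟩, -, -⟩ := hadm₃
  have hΛ := hasSubst_liftFam (k := k) hΨ'0
  refine ⟨fun l => subst ((Fin.cons (X 0) (fun j => rename (Fin.succEmb (m + 1)) (Ψ' j)) :
      Fin (m + 1 + 1) → MvPowerSeries (Fin (m + 1 + 1)) k)) (Φ l),
    subst ((Fin.cons (X 0) (fun j => rename (Fin.succEmb (m + 1)) (Ψ' j)) : Fin (m + 1 + 1) → MvPowerSeries (Fin (m + 1 + 1)) k)) u,
    rename (Fin.succEmb (m + 1)) v₃, α, (isCountMove_liftMove hΦ0 hΦdet hΨ'0 hΨ'det (w := fun _ => 1) (fun _ => le_rfl)).1,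
    (isCountMove_liftMove hΦ0 hΦdet hΨ'0 hΨ'det (w := fun _ => 1) (fun _ => le_rfl)).2.1, fun l hl => ?_, ?_, ?_, ?_⟩
  · obtain ⟨j, v, hv, hlj, hjE⟩ := hE l hl
    have hXj : (X j : MvPowerSeries (Fin (m + 1)) k) ∣ b₃ ^ (N₃ + 1) :=
      dvd_trans (dvd_trans (Finset.dvd_prod_of_mem _ hjE) (Dvd.intro_left _ rfl)) hTb
    obtain ⟨vj, ej, hvj, hXjΨ⟩ := TrackC.exists_unit_mul_monomial_of_dvd_pow Ψ' hΨ'0 U hU e hb N₃ hXj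
    rw [subst_X (hasSubst_of_constantCoeff_zero hΨ'0)] at hXjΨ
    obtain ⟨j', hj'⟩ := exists_eq_unit_mul_X_of_legal hΨ'0 hΨ'det hvj hXjΨ
    refine ⟨j'.succ, subst ((Fin.cons (X 0) (fun j => rename (Fin.succEmb (m + 1)) (Ψ' j)) :
      Fin (m + 1 + 1) → MvPowerSeries (Fin (m + 1 + 1)) k)) v * rename (Fin.succEmb (m + 1)) vj, Fin.succ_ne_zero _, ?_, liftMove_letter hΨ'0 hlj hj'⟩
    rw [map_mul, TOT2E1.constantCoeff_subst_of_constantCoeff_zero _ (constantCoeff_liftFam hΨ'0), constantCoeff_rename']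
    exact mul_ne_zero hv hvj
  · rw [TOT2E1.constantCoeff_subst_of_constantCoeff_zero _ (constantCoeff_liftFam hΨ'0)]
    exact hu
  · rw [constantCoeff_rename']
    exact hv₃
  · rw [← subst_comp_subst_apply (hasSubst_of_constantCoeff_zero hΦ0) hΛ, hf, subst_liftFam_pair hΨ'0, hgΨ, map_mul, map_prod]
    simp only [map_pow, rename_X, Fin.coe_succEmb]

end Exit

/-! # PART 8 — the start: from two smooth branches to a pair position with an admissible shadow -/

section Start

variable {m : ℕ}

/-- The order of the equation read through a legal coordinate change, from `o`. -/
theorem order_subst_eq_of_o {n : ℕ} {b : MvPowerSeries (Fin (n + 1)) k} {δ : Decoration k n} (hadm : Admissible b δ)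
    {Φ : Fin (n + 1) → MvPowerSeries (Fin (n + 1)) k} (hΦ0 : ∀ l, constantCoeff (Φ l) = 0)
    (hΦdet : IsUnit (Matrix.det (Matrix.of fun i j => coeff (Finsupp.single j 1) (Φ i)))) :
    (subst Φ δ.f).order = (δ.o : ℕ∞) := by
  have hfin : δ.f.order ≠ ⊤ := by rw [ne_eq, order_eq_top_iff]; exact hadm.2.1.ne_zero
  rw [NCTransport.order_subst_of_isUnit_det hΦ0 hΦdet δ.f, Decoration.o, ENat.coe_toNat hfin]

/-- **THE BRANCHES PASS THROUGH THE ORIGIN**: if `u · (X₀ + g₁) · (X₀ + g₂)` has order `2` (`u` a unit, `gᵢ` without `X₀`) then `gᵢ(0) = 0`. -/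
theorem constantCoeff_branches_eq_zero {n : ℕ} {u g₁ g₂ : MvPowerSeries (Fin (n + 1)) k} (hu : constantCoeff u ≠ 0)
    (hg₁ : ∀ d : Fin (n + 1) →₀ ℕ, d 0 ≠ 0 → coeff d g₁ = 0) (hg₂ : ∀ d : Fin (n + 1) →₀ ℕ, d 0 ≠ 0 → coeff d g₂ = 0)
    (h2 : (u * ((X 0 + g₁) * (X 0 + g₂))).order = 2) : constantCoeff g₁ = 0 ∧ constantCoeff g₂ = 0 := by
  have hle : ∀ g : MvPowerSeries (Fin (n + 1)) k, (∀ d : Fin (n + 1) →₀ ℕ, d 0 ≠ 0 → coeff d g = 0) → (X 0 + g).order ≤ 1 := by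
    intro g hg
    refine (order_le (d := Finsupp.single 0 1) ?_).trans (le_of_eq (by simp only [Finsupp.degree_single, Nat.cast_one]))
    rw [map_add, coeff_X, if_pos rfl, hg _ (by rw [Finsupp.single_eq_same]; exact one_ne_zero), add_zero]
    exact one_ne_zero
  have hcc : ∀ g : MvPowerSeries (Fin (n + 1)) k, (1 : ℕ∞) ≤ (X 0 + g).order → constantCoeff g = 0 := by
    intro g hg
    have := one_le_order_iff_constCoeff_eq_zero.mp hg
    rwa [map_add, constantCoeff_X, zero_add] at this
  rw [order_mul, order_mul, order_eq_zero_of_constantCoeff_ne_zero hu, zero_add] at h2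
  have h₁ := hle g₁ hg₁
  have h₂ := hle g₂ hg₂
  constructor
  · refine hcc g₁ ?_
    by_contra hlt
    have h0 : (X 0 + g₁).order = 0 := by
      by_contra hne; exact hlt (Order.one_le_iff_ne_zero.mpr hne)
    rw [h0, zero_add] at h2
    rw [h2] at h₂
    exact absurd h₂ (by decide)
  · refine hcc g₂ ?_
    by_contra hlt
    have h0 : (X 0 + g₂).order = 0 := by
      by_contra hne; exact hlt (Order.one_le_iff_ne_zero.mpr hne)
    rw [h0, add_zero] at h2
    rw [h2] at h₁
    exact absurd h₁ (by decide)

/-! ## The shear `x₀ ↦ x₀ − g₁` -/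

/-- The shear family is constant-free (when `g₁(0) = 0`). -/
theorem constantCoeff_shear {n : ℕ} {g₁ : MvPowerSeries (Fin (n + 1)) k} (hg₁ : constantCoeff g₁ = 0) (l : Fin (n + 1)) :
    constantCoeff ((Fin.cons (X 0 - g₁) (fun j => X j.succ) : Fin (n + 1) → MvPowerSeries (Fin (n + 1)) k) l) = 0 := by
  refine Fin.cases ?_ (fun j => ?_) l
  · rw [Fin.cons_zero, map_sub, constantCoeff_X, hg₁, sub_zero]
  · rw [Fin.cons_succ, constantCoeff_X]

/-- The linear part of the shear has determinant `1`. -/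
theorem det_shear {n : ℕ} {g₁ : MvPowerSeries (Fin (n + 1)) k} (hg₁ : ∀ d : Fin (n + 1) →₀ ℕ, d 0 ≠ 0 → coeff d g₁ = 0) :
    Matrix.det (Matrix.of fun i j => coeff (Finsupp.single j 1)
      (((Fin.cons (X 0 - g₁) (fun j => X j.succ) : Fin (n + 1) → MvPowerSeries (Fin (n + 1)) k)) i)) = 1 := by
  rw [Matrix.det_succ_column_zero, Finset.sum_eq_single (0 : Fin (n + 1))]
  · rw [Fin.val_zero, pow_zero, one_mul, Matrix.of_apply, Fin.cons_zero, map_sub, coeff_X, if_pos rfl,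
      hg₁ _ (by rw [Finsupp.single_eq_same]; exact one_ne_zero), sub_zero, one_mul]
    have h1 : (Matrix.of fun i j => coeff (Finsupp.single j 1)
        (((Fin.cons (X 0 - g₁) (fun j => X j.succ) : Fin (n + 1) → MvPowerSeries (Fin (n + 1)) k)) i)).submatrix
        (Fin.succAbove 0) Fin.succ = 1 := by
      ext i j
      rw [Matrix.submatrix_apply, Matrix.of_apply, Fin.succAbove_zero, Fin.cons_succ, coeff_X, Matrix.one_apply]
      by_cases hij : i = j
      · subst hij; rw [if_pos rfl, if_pos rfl]
      · rw [if_neg (fun h => hij (Fin.succ_injective _ (Finsupp.single_left_injective one_ne_zero h)).symm), if_neg hij]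
    rw [h1, Matrix.det_one]
  · intro i _ hi
    obtain ⟨i', rfl⟩ := Fin.exists_succ_eq_of_ne_zero hi
    rw [Matrix.of_apply, Fin.cons_succ, coeff_X, if_neg (fun h => Fin.succ_ne_zero i' (Finsupp.single_left_injective one_ne_zero h).symm),
      mul_zero, zero_mul]
  · exact fun h => absurd (Finset.mem_univ _) h

/-- The shear fixes the series without `X₀`. -/
theorem subst_shear_rename {n : ℕ} {g₁ : MvPowerSeries (Fin (n + 1)) k} (hg₁ : constantCoeff g₁ = 0) (G : MvPowerSeries (Fin n) k) :
    subst ((Fin.cons (X 0 - g₁) (fun j => X j.succ) : Fin (n + 1) → MvPowerSeries (Fin (n + 1)) k)) (rename (Fin.succEmb n) G) =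
      rename (Fin.succEmb n) G := by
  rw [subst_rename _ (hasSubst_of_constantCoeff_zero (constantCoeff_shear hg₁)), rename_eq_subst]
  rfl

/-- **THE SHEAR PUTS TWO BRANCHES IN PAIR POSITION**: `θ^*(u · (X₀ + g₁)(X₀ + g₂)) = θ^*u · X₀ · (X₀ + (g₂ − g₁))` (`gᵢ` without `X₀`). -/
theorem subst_shear_branches {n : ℕ} (G₁ G₂ : MvPowerSeries (Fin n) k) (hc₁ : constantCoeff (rename (Fin.succEmb n) G₁) = 0)
    (u : MvPowerSeries (Fin (n + 1)) k) :
    subst ((Fin.cons (X 0 - rename (Fin.succEmb n) G₁) (fun j => X j.succ) : Fin (n + 1) → MvPowerSeries (Fin (n + 1)) k))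
        (u * ((X 0 + rename (Fin.succEmb n) G₁) * (X 0 + rename (Fin.succEmb n) G₂))) =
      subst ((Fin.cons (X 0 - rename (Fin.succEmb n) G₁) (fun j => X j.succ) : Fin (n + 1) → MvPowerSeries (Fin (n + 1)) k)) u *
        (X 0 * (X 0 + rename (Fin.succEmb n) (G₂ - G₁))) := by
  have hθ := hasSubst_of_constantCoeff_zero (constantCoeff_shear (k := k) hc₁)
  rw [← coe_substAlgHom hθ]
  simp only [map_mul, map_add, map_sub, coe_substAlgHom, subst_X hθ, Fin.cons_zero, subst_shear_rename hc₁]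
  ring

/-! ## The admissible shadow -/

/-- Stripping the letters of `S` off a non-zero series: `r = r' · ∏_{j ∈ S} X_j^{e_j}` with no `X_j`, `j ∈ S`, dividing `r'`. -/
theorem exists_strip_letters {n : ℕ} {r : MvPowerSeries (Fin n) k} (hr : r ≠ 0) (S : Finset (Fin n)) :
    ∃ (r' : MvPowerSeries (Fin n) k) (e : Fin n → ℕ), r = r' * ∏ j ∈ S, X j ^ e j ∧ ∀ j ∈ S, ¬ X j ∣ r' := by
  classical
  haveI := uniqueFactorizationMonoid_mvPowerSeries (k := k) n
  induction S using Finset.induction_on with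
  | empty => exact ⟨r, fun _ => 0, by rw [Finset.prod_empty, mul_one], fun _ h => absurd h (Finset.notMem_empty _)⟩
  | insert a S haS ih =>
    obtain ⟨r', e, hr', hS⟩ := ih
    have hr'0 : r' ≠ 0 := by rintro rfl; rw [zero_mul] at hr'; exact hr hr'
    obtain ⟨na, r'', hndvd, hfac⟩ := WfDvdMonoid.max_power_factor hr'0 (MvPowerSeries.prime_X' k a).irreducible
    refine ⟨r'', Function.update e a na, ?_, fun j hj => ?_⟩
    · rw [Finset.prod_insert haS, Function.update_self, hr', hfac,
        Finset.prod_congr rfl fun j hj => show (X j : MvPowerSeries (Fin n) k) ^ Function.update e a na j = X j ^ e j by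
          rw [Function.update_of_ne (show j ≠ a from fun h => haS (h ▸ hj))]]
      ring
    · rw [Finset.mem_insert] at hj
      rcases hj with rfl | hj
      · exact hndvd
      · intro hd
        exact hS j hj (by rw [hfac]; exact dvd_mul_of_dvd_right hd _)

/-- **THE ADMISSIBLE SHADOW**: every non-zero `g₃` with a set `E₃` of boundary letters carries a decoration `(f₃, E₃, ∅)` admissible for
`g₃ · ∏_{j ∈ E₃} X_j`, with `f₃ ∣ g₃`. -/
theorem exists_admissible_shadow {g₃ : MvPowerSeries (Fin (m + 1)) k} (hg₃ : g₃ ≠ 0) (E₃ : Finset (Fin (m + 1))) :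
    ∃ f₃ : MvPowerSeries (Fin (m + 1)) k, f₃ ∣ g₃ ∧
      Admissible (g₃ * ∏ j ∈ E₃, X j) ({ f := f₃, E := E₃, O := ∅, O_subset := Finset.empty_subset _ } : Decoration k m) := by
  obtain ⟨N, hN⟩ := dvd_sqfRep_pow hg₃
  obtain ⟨f₃, e, hr, hS⟩ := exists_strip_letters (sqfRep_ne_zero hg₃) E₃
  have hf₃r : f₃ ∣ sqfRep g₃ := ⟨_, hr⟩
  set E := ∑ j ∈ E₃, e j with hE
  have htot : ({ f := f₃, E := E₃, O := ∅, O_subset := Finset.empty_subset _ } : Decoration k m).total = f₃ * ∏ j ∈ E₃, X j := rfl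
  have hrT : sqfRep g₃ ∣ (f₃ * ∏ j ∈ E₃, X j) ^ (E + 1) := by
    rw [hr, mul_pow, ← Finset.prod_pow]
    refine mul_dvd_mul (dvd_pow_self f₃ (Nat.succ_ne_zero E)) (Finset.prod_dvd_prod_of_dvd _ _ fun j hj => pow_dvd_pow _ ?_)
    exact (Finset.single_le_sum (f := e) (fun _ _ => Nat.zero_le _) hj).trans (Nat.le_succ E)
  refine ⟨f₃, hf₃r.trans (sqfRep_dvd g₃), ⟨(E + 1) * (N + 1), 0, ?_, ?_⟩, (squarefree_sqfRep hg₃).squarefree_of_dvd hf₃r, hS⟩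
  · rw [htot, pow_succ]
    refine mul_dvd_mul (hN.trans ?_) (dvd_mul_left _ _)
    rw [pow_mul]
    exact pow_dvd_pow_of_dvd hrT _
  · rw [htot, zero_add, pow_one]
    exact mul_dvd_mul (hf₃r.trans (sqfRep_dvd g₃)) dvd_rfl

/-- **THE START.**  Two smooth branches through a legal, boundary-straight `Φ` (no boundary letter on `X₀`) at `o = 2`: after the shear
`x₀ ↦ x₀ − g₁` the position is a pair position `Φ₁^*f = u₁ · X₀ · (X₀ + g₃)` over the ADMISSIBLE SHADOW `(g₃ · ∏ letters, (f₃, E₃, ∅))`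
(`f₃ ∣ g₃`, boundary letters over `E₃`). -/
theorem exists_start {b : MvPowerSeries (Fin (m + 1 + 1)) k} {δ : Decoration k (m + 1)} (hadm : Admissible b δ) (ho : δ.o = 2)
    {Φ : Fin (m + 1 + 1) → MvPowerSeries (Fin (m + 1 + 1)) k} (hΦ0 : ∀ i, constantCoeff (Φ i) = 0)
    (hΦdet : IsUnit (Matrix.det (Matrix.of fun i j => coeff (Finsupp.single j 1) (Φ i))))
    (hE : ∀ l ∈ δ.E, ∃ (l' : Fin (m + 1 + 1)) (v : MvPowerSeries (Fin (m + 1 + 1)) k), l' ≠ 0 ∧ constantCoeff v ≠ 0 ∧ Φ l = v * X l')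
    {u g₁ g₂ : MvPowerSeries (Fin (m + 1 + 1)) k} (hu : constantCoeff u ≠ 0) (hg₁ : ∀ d : Fin (m + 1 + 1) →₀ ℕ, d 0 ≠ 0 → coeff d g₁ = 0)
    (hg₂ : ∀ d : Fin (m + 1 + 1) →₀ ℕ, d 0 ≠ 0 → coeff d g₂ = 0) (hf : subst Φ δ.f = u * ((X 0 + g₁) * (X 0 + g₂))) :
    ∃ (Φ₁ : Fin (m + 1 + 1) → MvPowerSeries (Fin (m + 1 + 1)) k) (u₁ : MvPowerSeries (Fin (m + 1 + 1)) k) (g₃ b₃ : MvPowerSeries (Fin (m + 1)) k)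
      (δ₃ : Decoration k m),
      (∀ i, constantCoeff (Φ₁ i) = 0) ∧ IsUnit (Matrix.det (Matrix.of fun i j => coeff (Finsupp.single j 1) (Φ₁ i))) ∧
      (∀ l ∈ δ.E, ∃ (j : Fin (m + 1)) (v : MvPowerSeries (Fin (m + 1 + 1)) k), constantCoeff v ≠ 0 ∧ Φ₁ l = v * X j.succ ∧ j ∈ δ₃.E) ∧
      constantCoeff u₁ ≠ 0 ∧ subst Φ₁ δ.f = u₁ * (X 0 * (X 0 + rename (Fin.succEmb (m + 1)) g₃)) ∧
      Admissible b₃ δ₃ ∧ δ₃.O = ∅ ∧ δ₃.f ∣ g₃ ^ 1 ∧ g₃ ∣ b₃ ^ 1 := by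
  classical
  -- the branches pass through the origin
  have hord : (u * ((X 0 + g₁) * (X 0 + g₂))).order = 2 := by rw [← hf, order_subst_eq_of_o hadm hΦ0 hΦdet, ho]; rfl
  obtain ⟨hc₁, -⟩ := constantCoeff_branches_eq_zero hu hg₁ hg₂ hord
  -- the shear
  set G₁ : MvPowerSeries (Fin (m + 1)) k := killCompl (Fin.succEmb (m + 1)) g₁ with hG₁
  set G₂ : MvPowerSeries (Fin (m + 1)) k := killCompl (Fin.succEmb (m + 1)) g₂ with hG₂
  have e₁ : rename (Fin.succEmb (m + 1)) G₁ = g₁ := rename_killCompl_of_coeff_eq_zero hg₁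
  have e₂ : rename (Fin.succEmb (m + 1)) G₂ = g₂ := rename_killCompl_of_coeff_eq_zero hg₂
  have hc₁' : constantCoeff (rename (Fin.succEmb (m + 1)) G₁) = 0 := by rw [e₁]; exact hc₁
  set θ : Fin (m + 1 + 1) → MvPowerSeries (Fin (m + 1 + 1)) k := Fin.cons (X 0 - rename (Fin.succEmb (m + 1)) G₁) (fun j => X j.succ) with hθdef
  have hθ0 : ∀ l, constantCoeff (θ l) = 0 := constantCoeff_shear hc₁'
  have hθ : HasSubst θ := hasSubst_of_constantCoeff_zero hθ0
  have hθmv : IsCountMove θ (fun _ => 1) :=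
    ⟨hθ0, by rw [hθdef, det_shear (fun d hd => coeff_rename_succ_eq_zero _ hd)]; exact isUnit_one, fun _ => le_rfl, ⟨0, Nat.one_pos⟩⟩
  have hΦ₁ := isCountMove_comp hΦ0 hΦdet hθmv
  set g₃ : MvPowerSeries (Fin (m + 1)) k := G₂ - G₁ with hg₃def
  have hf₁ : subst (fun l => subst θ (Φ l)) δ.f = subst θ u * (X 0 * (X 0 + rename (Fin.succEmb (m + 1)) g₃)) := by
    rw [← subst_comp_subst_apply (hasSubst_of_constantCoeff_zero hΦ0) hθ, hf, ← e₁, ← e₂, hθdef, subst_shear_branches G₁ G₂ hc₁' u]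
  -- `g₃ ≠ 0`: else `Φ₁^*f = unit · X₀²` would not be squarefree
  have hg₃ : g₃ ≠ 0 := by
    intro h0
    have hsq : Squarefree (subst (fun l => subst θ (Φ l)) δ.f) := squarefree_subst_of_legal hΦ₁.1 hΦ₁.2.1 hadm.2.1
    rw [hf₁, h0, map_zero, add_zero] at hsq
    have hX := hsq (X 0) ⟨subst θ u, by ring⟩
    rw [MvPowerSeries.isUnit_iff_constantCoeff, constantCoeff_X, isUnit_iff_ne_zero] at hX
    exact hX rfl
  -- the shadow letters and the admissible shadow
  set E₃ : Finset (Fin (m + 1)) := δ.E.image (fun l => Fin.predAbove 0 (strIdx Φ l)) with hE₃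
  obtain ⟨f₃, hf₃g, hadm₃⟩ := exists_admissible_shadow hg₃ E₃
  refine ⟨fun l => subst θ (Φ l), subst θ u, g₃, g₃ * ∏ j ∈ E₃, X j, _, hΦ₁.1, hΦ₁.2.1, fun l hl => ?_, ?_, hf₁, hadm₃, rfl,
    by rw [pow_one]; exact hf₃g, by rw [pow_one]; exact dvd_mul_right _ _⟩
  · obtain ⟨l', v, hl', hv, hlv⟩ := hE l hl
    obtain ⟨j, rfl⟩ := Fin.exists_succ_eq_of_ne_zero hl'
    refine ⟨j, subst θ v, by rw [TOT2E1.constantCoeff_subst_of_constantCoeff_zero _ hθ0]; exact hv, ?_, ?_⟩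
    · show subst θ (Φ l) = subst θ v * X j.succ
      rw [hlv, ← coe_substAlgHom hθ, map_mul, coe_substAlgHom, subst_X hθ, hθdef, Fin.cons_succ]
    · show j ∈ E₃
      rw [hE₃, Finset.mem_image]
      exact ⟨l, hl, by rw [strIdx_eq_of_eq' hv hlv, Fin.predAbove_zero_succ]⟩
  · rw [TOT2E1.constantCoeff_subst_of_constantCoeff_zero _ hθ0]
    exact hu

end Start

end PairLift

end TameFourTupleDrop

end Summit.ResolutionOfSingularities.ResolutionOfSingularities.Theorems

end
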